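import Mathlib
import Literature.MathematicalPhysics.QuantumLattice.WilsonDiracAP
import Summits.QuantumFields.QCD.Theorems.QuarksAsStableActionCriticalLineDiamagnetismStubBlockHessianFormulaAux
import Summits.QuantumFields.QCD.Theorems.QuarksAsStableActionCriticalLineDiamagnetismStubBlockHessianFormulaAuxB

/-!
# The block Hessian of the free Wilson–Dirac determinant in momentum space
(helper for crux stmt-QuantumFields-9734, line `Sketch`, stub `stub_blockHessianFormula`)

What.  On the `2⁴` block `(ℤ/2)⁴` (colour `Fin 3`, spin `Fin 4`) with constant central link phases
`u_μ = e^{iθ_μ}·1`, free `r = 1` Wilson–Dirac operator `B⁰` and hopping perturbation `Δ(Y)`, the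
one-loop block Hessian `Q_θ(Y) = ½ Re tr (B⁰⁻¹ΔY B⁰⁻¹ΔY) − ½ Re tr (B⁰⁻¹Δ(Y⋆Y))` of an
anti-Hermitian link field `Y` is the explicit momentum-space quadratic form
`Q_θ(Y) = (1/256) Σ_s Σ_{μν} H_θ(s)_{μν} Re tr (Ŷ_μ(s)ᴴ Ŷ_ν(s))`, `Ŷ_μ(s) = Σ_x (−1)^{s·x} Y(x,μ)` the
Walsh transform, with `H = ½ X δ_{μν} + ½ Re B`: the tadpole `X_μ = Σ_{s'} 4(sin² P_μ − M_W cos P_μ)/h`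
and the bubble `B_{μν}(s) = Σ_{s'} tr (S(P) V_ν(P+q, q) S(P+q) V_μ(P, q))`, `P = θ + πs'`, `q = πs`,
`S(P) = (M_W − iγ·sin P)/h` the free propagator and `V` the `r = 1` vertices (`stub_blockHessianFormula`).

How.  `BlockHessianFormula.trace_formulas` (aux stub A: `B⁰⁻¹ = P·blockdiag(1 ⊗ S)·Pᴴ`, traces as sums
over the 16 block momenta) and `BlockHessianFormula.hat_hop` (aux stub B: the momentum blocks of `Δ(E)`);
for anti-Hermitian `Y` the blocks are `Σ_ν Ŷ_ν(k+k') ⊗ Ṽ_ν(k,k')` (`hat_hop_antiHerm`), the Kronecker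
traces factor into colour × spin traces, `tr (Ŷ_ν Ŷ_μ) = −tr (Ŷ_μᴴ Ŷ_ν)` is real
(`trace_mul_of_antiHerm`), the double momentum sum is re-indexed by the Walsh transfer `s = k + k'`
(`sum_reindex`), and the vertices/propagators at `θ + π(s'+s)` are those at `θ + πs' + πs`
(`2π`-periodicity in the representatives, `trig_val_add`); the tadpole uses `parseval` and the spin
trace `trace_symbolInv_mul_hop`.  Numerics (lead c3, `numerics/literal3.py`): identity to 5e-14.

References: Montvay–Münster, *Quantum Fields on a Lattice* §4.2 (free Wilson fermions and the hopping
expansion in momentum space); folklore.  Pure theorem file (no `def`s).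
-/

noncomputable section

open scoped BigOperators Classical Matrix ComplexConjugate
open Finset
open Literature.MathematicalPhysics.QuantumLattice Literature.MathematicalPhysics.QuantumFieldTheory
  Literature.Probability.LatticeModels

namespace Summit.QuantumFields.QCD.Cruxes.CriticalLineDiamagnetism.ChessboardCellGain

open scoped Kronecker
open Complex (I)

namespace BlockHessianFormula

/-! ### The blocks of `Δ(Y)` and `Δ(Y⋆Y)`, the propagators and vertices at shifted momenta -/

section Main

variable (m : ℝ) (θ : Fin 4 → ℝ) (u : Fin 4 → Matrix.unitaryGroup (Fin 3) ℂ)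
  (B0 : Matrix (TorusSite 4 2 × Fin 3 × Fin 4) (TorusSite 4 2 × Fin 3 × Fin 4) ℂ)
  (Dl : (Edge 4 2 → Matrix (Fin 3) (Fin 3) ℂ) →
    Matrix (TorusSite 4 2 × Fin 3 × Fin 4) (TorusSite 4 2 × Fin 3 × Fin 4) ℂ)
  (Mw h : (Fin 4 → ℝ) → ℝ) (S : (Fin 4 → ℝ) → Matrix (Fin 4) (Fin 4) ℂ)
  (V : (Fin 4 → ℝ) → (Fin 4 → ℝ) → Fin 4 → Matrix (Fin 4) (Fin 4) ℂ)
  (mom qv : (Fin 4 → ZMod 2) → Fin 4 → ℝ)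
  (chi : (Fin 4 → ZMod 2) → TorusSite 4 2 → ℝ)
  (Yh : (Edge 4 2 → Matrix (Fin 3) (Fin 3) ℂ) → (Fin 4 → ZMod 2) → Fin 4 → Matrix (Fin 3) (Fin 3) ℂ)
  (hat : Matrix (TorusSite 4 2 × Fin 3 × Fin 4) (TorusSite 4 2 × Fin 3 × Fin 4) ℂ →
    (Fin 4 → ZMod 2) → (Fin 4 → ZMod 2) → Matrix (Fin 3 × Fin 4) (Fin 3 × Fin 4) ℂ)
  (Y : Edge 4 2 → Matrix (Fin 3) (Fin 3) ℂ)

/-- For anti-Hermitian `Y` the Walsh transforms are anti-Hermitian. -/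
theorem walsh_antiHerm (hYh : ∀ E s μ, Yh E s μ = ∑ x, ((chi s x : ℝ) : ℂ) • E (x, μ))
    (hY : ∀ e, (Y e)ᴴ = -Y e) (s : Fin 4 → ZMod 2) (ν : Fin 4) : (Yh Y s ν)ᴴ = -Yh Y s ν := by
  rw [hYh, Matrix.conjTranspose_sum, ← Finset.sum_neg_distrib]
  refine Finset.sum_congr rfl fun x _ => ?_
  rw [Matrix.conjTranspose_smul, hY, smul_neg, Complex.star_def, Complex.conj_ofReal]

/-- **Blocks of `Δ(Y)` for anti-Hermitian `Y`**: `Δ̂(Y)(k,k') = Σ_ν Ŷ_ν(k+k') ⊗ Ṽ_ν(k,k')`,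
`Ṽ_ν(k,k') = −½ e^{iP_{k'}ν}(1 − γ_ν) + ½ e^{−iP_k ν}(1 + γ_ν)`. -/
theorem hat_hop_antiHerm
    (hu : ∀ μ, (u μ : Matrix (Fin 3) (Fin 3) ℂ) = Complex.exp (↑(θ μ) * I) • (1 : Matrix (Fin 3) (Fin 3) ℂ))
    (hDl : ∀ E, Dl E = Matrix.of fun p q : TorusSite 4 2 × Fin 3 × Fin 4 => -(1 / 2 : ℂ) * ∑ μ : Fin 4,
      ((if q.1 = Site.shift p.1 μ then ((1 : Matrix (Fin 4) (Fin 4) ℂ) - euclideanGamma μ) p.2.2 q.2.2 *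
          ((u μ : Matrix (Fin 3) (Fin 3) ℂ) * E (p.1, μ)) p.2.1 q.2.1 else 0) +
        (if p.1 = Site.shift q.1 μ then ((1 : Matrix (Fin 4) (Fin 4) ℂ) + euclideanGamma μ) p.2.2 q.2.2 *
          ((u μ : Matrix (Fin 3) (Fin 3) ℂ) * E (q.1, μ))ᴴ p.2.1 q.2.1 else 0)))
    (hmom : ∀ s κ, mom s κ = θ κ + Real.pi * ((s κ).val : ℝ))
    (hchi : ∀ s x, chi s x = (-1 : ℝ) ^ (∑ κ, (s κ).val * (x κ).val))
    (hYh : ∀ E s μ, Yh E s μ = ∑ x, ((chi s x : ℝ) : ℂ) • E (x, μ))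
    (hhat : ∀ A k k', hat A k k' =
      ∑ y, ∑ z, ((chi k y * chi k' z : ℝ) : ℂ) • Matrix.of fun c c' : Fin 3 × Fin 4 => A (y, c) (z, c'))
    (hY : ∀ e, (Y e)ᴴ = -Y e) (k k' : Fin 4 → ZMod 2) :
    hat (Dl Y) k k' = ∑ ν, Yh Y (k + k') ν ⊗ₖ
      ((-(1 / 2 : ℂ) * Complex.exp (↑(mom k' ν) * I)) • ((1 : Matrix (Fin 4) (Fin 4) ℂ) - euclideanGamma ν) +
        ((1 / 2 : ℂ) * Complex.exp (-(↑(mom k ν) * I))) • ((1 : Matrix (Fin 4) (Fin 4) ℂ) + euclideanGamma ν)) := by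
  have e2 : ∀ (A : Matrix (Fin 3) (Fin 3) ℂ) (b : ℂ) (G' : Matrix (Fin 4) (Fin 4) ℂ),
      b • ((-A) ⊗ₖ G') = (-b) • (A ⊗ₖ G') := fun A b G' => by
    rw [← neg_one_smul ℂ A, Matrix.smul_kronecker, smul_smul, mul_neg_one]
  rw [hat_hop θ u Dl mom chi Yh hat hu hDl hmom hchi hYh hhat Y k k']
  refine Finset.sum_congr rfl fun ν _ => ?_
  rw [walsh_antiHerm chi Yh Y hYh hY, e2, kron_smul_add]
  congr 2
  ring

/-- **Diagonal blocks of `Δ(Y⋆Y)`**: `Δ̂(Y⋆Y)(k,k) = Σ_ν Ẑ_ν ⊗ (−½ e^{iP_k ν}(1 − γ_ν) − ½ e^{−iP_k ν}(1 + γ_ν))`,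
`Ẑ_ν = Σ_x Y(x,ν)²` the zero-momentum Walsh component (`Y⋆Y` is linkwise Hermitian). -/
theorem hat_hop_sq
    (hu : ∀ μ, (u μ : Matrix (Fin 3) (Fin 3) ℂ) = Complex.exp (↑(θ μ) * I) • (1 : Matrix (Fin 3) (Fin 3) ℂ))
    (hDl : ∀ E, Dl E = Matrix.of fun p q : TorusSite 4 2 × Fin 3 × Fin 4 => -(1 / 2 : ℂ) * ∑ μ : Fin 4,
      ((if q.1 = Site.shift p.1 μ then ((1 : Matrix (Fin 4) (Fin 4) ℂ) - euclideanGamma μ) p.2.2 q.2.2 *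
          ((u μ : Matrix (Fin 3) (Fin 3) ℂ) * E (p.1, μ)) p.2.1 q.2.1 else 0) +
        (if p.1 = Site.shift q.1 μ then ((1 : Matrix (Fin 4) (Fin 4) ℂ) + euclideanGamma μ) p.2.2 q.2.2 *
          ((u μ : Matrix (Fin 3) (Fin 3) ℂ) * E (q.1, μ))ᴴ p.2.1 q.2.1 else 0)))
    (hmom : ∀ s κ, mom s κ = θ κ + Real.pi * ((s κ).val : ℝ))
    (hchi : ∀ s x, chi s x = (-1 : ℝ) ^ (∑ κ, (s κ).val * (x κ).val))
    (hYh : ∀ E s μ, Yh E s μ = ∑ x, ((chi s x : ℝ) : ℂ) • E (x, μ))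
    (hhat : ∀ A k k', hat A k k' =
      ∑ y, ∑ z, ((chi k y * chi k' z : ℝ) : ℂ) • Matrix.of fun c c' : Fin 3 × Fin 4 => A (y, c) (z, c'))
    (hY : ∀ e, (Y e)ᴴ = -Y e) (k : Fin 4 → ZMod 2) :
    hat (Dl fun e => Y e * Y e) k k = ∑ ν, Yh (fun e => Y e * Y e) 0 ν ⊗ₖ
      ((-(1 / 2 : ℂ) * Complex.exp (↑(mom k ν) * I)) • ((1 : Matrix (Fin 4) (Fin 4) ℂ) - euclideanGamma ν) +
        (-(1 / 2 : ℂ) * Complex.exp (-(↑(mom k ν) * I))) • ((1 : Matrix (Fin 4) (Fin 4) ℂ) + euclideanGamma ν)) := by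
  have hkk : k + k = 0 := by simpa only [add_zero] using add_add_cancel_left k 0
  have hherm : ∀ ν, (Yh (fun e => Y e * Y e) 0 ν)ᴴ = Yh (fun e => Y e * Y e) 0 ν := fun ν => by
    simp only [hYh, Matrix.conjTranspose_sum, Matrix.conjTranspose_smul, Matrix.conjTranspose_mul, hY,
      neg_mul_neg, Complex.star_def, Complex.conj_ofReal]
  rw [hat_hop θ u Dl mom chi Yh hat hu hDl hmom hchi hYh hhat _ k k, hkk]
  refine Finset.sum_congr rfl fun ν _ => ?_
  rw [hherm, kron_smul_add]

/-- The free propagator at `θ + π(k+s)` is the one at `θ + πk + πs` (`2π`-periodicity). -/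
theorem symbolInv_periodic (hMw : ∀ P, Mw P = m + ∑ κ, (1 - Real.cos (P κ)))
    (hh : ∀ P, h P = Mw P ^ 2 + ∑ κ, Real.sin (P κ) ^ 2)
    (hS : ∀ P, S P = ((h P)⁻¹ : ℂ) • (((Mw P : ℝ) : ℂ) • (1 : Matrix (Fin 4) (Fin 4) ℂ) -
      I • ∑ κ, ((Real.sin (P κ) : ℝ) : ℂ) • euclideanGamma κ))
    (hmom : ∀ s κ, mom s κ = θ κ + Real.pi * ((s κ).val : ℝ))
    (hqv : ∀ s κ, qv s κ = Real.pi * ((s κ).val : ℝ)) (k s : Fin 4 → ZMod 2) :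
    S (mom (k + s)) = S (mom k + qv s) := by
  have hc : ∀ κ, Real.cos (mom (k + s) κ) = Real.cos ((mom k + qv s) κ) := fun κ => by
    rw [Pi.add_apply (mom k), hmom, hmom, hqv, Pi.add_apply]; exact (trig_val_add _ _ _).1
  have hs' : ∀ κ, Real.sin (mom (k + s) κ) = Real.sin ((mom k + qv s) κ) := fun κ => by
    rw [Pi.add_apply (mom k), hmom, hmom, hqv, Pi.add_apply]; exact (trig_val_add _ _ _).2.1
  rw [hS, hS, hh, hh, hMw, hMw]
  simp only [hc, hs']

/-- The outgoing vertex at shifted momenta: `Ṽ_ν(s', s'+s) = −i V_ν(P_{s'} + q_s, q_s)`. -/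
theorem vertex_out
    (hV : ∀ P q μ, V P q μ = (-(1 / 2 : ℂ) * (Complex.exp (↑(P μ) * I) * I)) •
        ((1 : Matrix (Fin 4) (Fin 4) ℂ) - euclideanGamma μ) +
      (-(1 / 2 : ℂ) * (Complex.exp (-(↑(P μ + q μ) * I)) * (-I))) • ((1 : Matrix (Fin 4) (Fin 4) ℂ) + euclideanGamma μ))
    (hmom : ∀ s κ, mom s κ = θ κ + Real.pi * ((s κ).val : ℝ))
    (hqv : ∀ s κ, qv s κ = Real.pi * ((s κ).val : ℝ)) (s' s : Fin 4 → ZMod 2) (ν : Fin 4) :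
    (-(1 / 2 : ℂ) * Complex.exp (↑(mom (s' + s) ν) * I)) • ((1 : Matrix (Fin 4) (Fin 4) ℂ) - euclideanGamma ν) +
        ((1 / 2 : ℂ) * Complex.exp (-(↑(mom s' ν) * I))) • ((1 : Matrix (Fin 4) (Fin 4) ℂ) + euclideanGamma ν) =
      (-I) • V (mom s' + qv s) (qv s) ν := by
  have e1 : Complex.exp (↑(mom (s' + s) ν) * I) = Complex.exp (↑((mom s' + qv s) ν) * I) := by
    rw [Pi.add_apply (mom s'), hmom, hmom, hqv, Pi.add_apply]; exact (trig_val_add _ _ _).2.2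
  have e2 : Complex.exp (-(↑((mom s' + qv s) ν + qv s ν) * I)) = Complex.exp (-(↑(mom s' ν) * I)) := by
    rw [Pi.add_apply (mom s'), hqv, show mom s' ν + Real.pi * ((s ν).val : ℝ) + Real.pi * ((s ν).val : ℝ) =
      mom s' ν + ((s ν).val : ℕ) * (2 * Real.pi) by ring, Complex.exp_neg, Complex.exp_neg,
      exp_add_nat_mul_two_pi]
  rw [hV, e2, ← e1, smul_add (-I), smul_smul, smul_smul]
  congr 2
  · linear_combination (-(1 / 2 : ℂ) * Complex.exp (↑(mom (s' + s) ν) * I)) * Complex.I_sq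
  · linear_combination ((1 / 2 : ℂ) * Complex.exp (-(↑(mom s' ν) * I))) * Complex.I_sq

/-- The incoming vertex at shifted momenta: `Ṽ_μ(s'+s, s') = −i V_μ(P_{s'}, q_s)`. -/
theorem vertex_in
    (hV : ∀ P q μ, V P q μ = (-(1 / 2 : ℂ) * (Complex.exp (↑(P μ) * I) * I)) •
        ((1 : Matrix (Fin 4) (Fin 4) ℂ) - euclideanGamma μ) +
      (-(1 / 2 : ℂ) * (Complex.exp (-(↑(P μ + q μ) * I)) * (-I))) • ((1 : Matrix (Fin 4) (Fin 4) ℂ) + euclideanGamma μ))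
    (hmom : ∀ s κ, mom s κ = θ κ + Real.pi * ((s κ).val : ℝ))
    (hqv : ∀ s κ, qv s κ = Real.pi * ((s κ).val : ℝ)) (s' s : Fin 4 → ZMod 2) (μ : Fin 4) :
    (-(1 / 2 : ℂ) * Complex.exp (↑(mom s' μ) * I)) • ((1 : Matrix (Fin 4) (Fin 4) ℂ) - euclideanGamma μ) +
        ((1 / 2 : ℂ) * Complex.exp (-(↑(mom (s' + s) μ) * I))) • ((1 : Matrix (Fin 4) (Fin 4) ℂ) + euclideanGamma μ) =
      (-I) • V (mom s') (qv s) μ := by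
  have e1 : Complex.exp (-(↑(mom (s' + s) μ) * I)) = Complex.exp (-(↑(mom s' μ + qv s μ) * I)) := by
    rw [Complex.exp_neg, Complex.exp_neg, hmom, hmom, hqv, Pi.add_apply, (trig_val_add _ _ _).2.2]
  rw [hV, e1, smul_add (-I), smul_smul, smul_smul]
  congr 2
  · linear_combination (-(1 / 2 : ℂ) * Complex.exp (↑(mom s' μ) * I)) * Complex.I_sq
  · linear_combination ((1 / 2 : ℂ) * Complex.exp (-(↑(mom s' μ + qv s μ) * I))) * Complex.I_sq

/-! ### The two halves and the assembly -/

/-- **The bubble in momentum space**: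
`½ Re tr (B⁰⁻¹ΔY B⁰⁻¹ΔY) = (1/256) Σ_{s,μ,ν} ½ Re B_{μν}(s) · Re tr (Ŷ_μ(s)ᴴ Ŷ_ν(s))`. -/
theorem bubble_eq
    (hu : ∀ μ, (u μ : Matrix (Fin 3) (Fin 3) ℂ) = Complex.exp (↑(θ μ) * I) • (1 : Matrix (Fin 3) (Fin 3) ℂ))
    (hB0 : B0 = wilsonDirac (unitaryFundamentalRep (Fin 3) ℂ) (fun e : Edge 4 2 => u e.2) m 1)
    (hDl : ∀ E, Dl E = Matrix.of fun p q : TorusSite 4 2 × Fin 3 × Fin 4 => -(1 / 2 : ℂ) * ∑ μ : Fin 4,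
      ((if q.1 = Site.shift p.1 μ then ((1 : Matrix (Fin 4) (Fin 4) ℂ) - euclideanGamma μ) p.2.2 q.2.2 *
          ((u μ : Matrix (Fin 3) (Fin 3) ℂ) * E (p.1, μ)) p.2.1 q.2.1 else 0) +
        (if p.1 = Site.shift q.1 μ then ((1 : Matrix (Fin 4) (Fin 4) ℂ) + euclideanGamma μ) p.2.2 q.2.2 *
          ((u μ : Matrix (Fin 3) (Fin 3) ℂ) * E (q.1, μ))ᴴ p.2.1 q.2.1 else 0)))
    (hMw : ∀ P, Mw P = m + ∑ κ, (1 - Real.cos (P κ)))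
    (hh : ∀ P, h P = Mw P ^ 2 + ∑ κ, Real.sin (P κ) ^ 2)
    (hS : ∀ P, S P = ((h P)⁻¹ : ℂ) • (((Mw P : ℝ) : ℂ) • (1 : Matrix (Fin 4) (Fin 4) ℂ) -
      I • ∑ κ, ((Real.sin (P κ) : ℝ) : ℂ) • euclideanGamma κ))
    (hV : ∀ P q μ, V P q μ = (-(1 / 2 : ℂ) * (Complex.exp (↑(P μ) * I) * I)) •
        ((1 : Matrix (Fin 4) (Fin 4) ℂ) - euclideanGamma μ) +
      (-(1 / 2 : ℂ) * (Complex.exp (-(↑(P μ + q μ) * I)) * (-I))) • ((1 : Matrix (Fin 4) (Fin 4) ℂ) + euclideanGamma μ))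
    (hmom : ∀ s κ, mom s κ = θ κ + Real.pi * ((s κ).val : ℝ))
    (hqv : ∀ s κ, qv s κ = Real.pi * ((s κ).val : ℝ))
    (hchi : ∀ s x, chi s x = (-1 : ℝ) ^ (∑ κ, (s κ).val * (x κ).val))
    (hYh : ∀ E s μ, Yh E s μ = ∑ x, ((chi s x : ℝ) : ℂ) • E (x, μ))
    (hpos : ∀ s, 0 < h (mom s)) (hY : ∀ e, (Y e)ᴴ = -Y e) :
    (B0⁻¹ * Dl Y * (B0⁻¹ * Dl Y)).trace.re / 2 = (1 / 256 : ℝ) * ∑ s, ∑ μ, ∑ ν,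
      ((1 / 2 : ℝ) * (∑ s', (S (mom s') * V (mom s' + qv s) (qv s) ν * S (mom s' + qv s) *
        V (mom s') (qv s) μ).trace).re) * ((Yh Y s μ)ᴴ * Yh Y s ν).trace.re := by
  obtain ⟨hat, hhat⟩ : ∃ hat : Matrix (TorusSite 4 2 × Fin 3 × Fin 4) (TorusSite 4 2 × Fin 3 × Fin 4) ℂ →
      (Fin 4 → ZMod 2) → (Fin 4 → ZMod 2) → Matrix (Fin 3 × Fin 4) (Fin 3 × Fin 4) ℂ, ∀ A k k', hat A k k' =
        ∑ y, ∑ z, ((chi k y * chi k' z : ℝ) : ℂ) • Matrix.of fun c c' : Fin 3 × Fin 4 => A (y, c) (z, c') :=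
    ⟨_, fun _ _ _ => rfl⟩
  have hanti := walsh_antiHerm chi Yh Y hYh hY
  have hG : ∀ (s : Fin 4 → ZMod 2) (μ ν : Fin 4),
      (Yh Y s ν * Yh Y s μ).trace = -((Yh Y s μ)ᴴ * Yh Y s ν).trace := fun s μ ν => by
    rw [Matrix.trace_mul_comm, (trace_mul_of_antiHerm _ _ (hanti s μ) (hanti s ν)).1, neg_neg]
  have hGim : ∀ (s : Fin 4 → ZMod 2) (μ ν : Fin 4), (((Yh Y s μ)ᴴ * Yh Y s ν).trace).im = 0 := fun s μ ν => by
    rw [(trace_mul_of_antiHerm _ _ (hanti s μ) (hanti s ν)).1, Complex.neg_im,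
      (trace_mul_of_antiHerm _ _ (hanti s μ) (hanti s ν)).2, neg_zero]
  have hsc : ∀ G T : ℂ, -G * (-I * (-I * T)) = G * T := fun G T => by
    linear_combination (-G * T) * Complex.I_sq
  -- the summand at Walsh transfer `s` and loop momentum `s'`
  have hterm : ∀ s s' : Fin 4 → ZMod 2,
      ((1 : Matrix (Fin 3) (Fin 3) ℂ) ⊗ₖ S (mom s') * hat (Dl Y) s' (s' + s) *
        ((1 : Matrix (Fin 3) (Fin 3) ℂ) ⊗ₖ S (mom (s' + s)) * hat (Dl Y) (s' + s) s')).trace =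
      ∑ μ, ∑ ν, ((Yh Y s μ)ᴴ * Yh Y s ν).trace *
        (S (mom s') * V (mom s' + qv s) (qv s) ν * S (mom s' + qv s) * V (mom s') (qv s) μ).trace := by
    intro s s'
    rw [hat_hop_antiHerm θ u Dl mom chi Yh hat Y hu hDl hmom hchi hYh hhat hY,
      hat_hop_antiHerm θ u Dl mom chi Yh hat Y hu hDl hmom hchi hYh hhat hY, add_add_cancel_left,
      show s' + s + s' = s by rw [add_comm]; exact add_add_cancel_left s' s, trace_kron_two]
    refine Finset.sum_congr rfl fun μ _ => Finset.sum_congr rfl fun ν _ => ?_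
    rw [vertex_out θ V mom qv hV hmom hqv, vertex_in θ V mom qv hV hmom hqv,
      symbolInv_periodic m θ Mw h S mom qv hMw hh hS hmom hqv, hG]
    simp only [Matrix.mul_smul, Matrix.smul_mul, Matrix.trace_smul, smul_eq_mul, Matrix.mul_assoc]
    exact hsc _ _
  rw [(trace_formulas m θ u B0 Mw h S mom chi hat hu hB0 hMw hh hS hmom hchi hhat hpos).2 (Dl Y) (Dl Y),
    sum_reindex]
  simp only [hterm]
  exact re_bubble_bookkeeping _ _ hGim

/-- **The tadpole in momentum space**:
`½ Re tr (B⁰⁻¹Δ(Y⋆Y)) = −(1/256) Σ_{s,μ,ν} [μ = ν] ½ X_μ · Re tr (Ŷ_μ(s)ᴴ Ŷ_ν(s))`. -/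
theorem tadpole_eq
    (hu : ∀ μ, (u μ : Matrix (Fin 3) (Fin 3) ℂ) = Complex.exp (↑(θ μ) * I) • (1 : Matrix (Fin 3) (Fin 3) ℂ))
    (hB0 : B0 = wilsonDirac (unitaryFundamentalRep (Fin 3) ℂ) (fun e : Edge 4 2 => u e.2) m 1)
    (hDl : ∀ E, Dl E = Matrix.of fun p q : TorusSite 4 2 × Fin 3 × Fin 4 => -(1 / 2 : ℂ) * ∑ μ : Fin 4,
      ((if q.1 = Site.shift p.1 μ then ((1 : Matrix (Fin 4) (Fin 4) ℂ) - euclideanGamma μ) p.2.2 q.2.2 *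
          ((u μ : Matrix (Fin 3) (Fin 3) ℂ) * E (p.1, μ)) p.2.1 q.2.1 else 0) +
        (if p.1 = Site.shift q.1 μ then ((1 : Matrix (Fin 4) (Fin 4) ℂ) + euclideanGamma μ) p.2.2 q.2.2 *
          ((u μ : Matrix (Fin 3) (Fin 3) ℂ) * E (q.1, μ))ᴴ p.2.1 q.2.1 else 0)))
    (hMw : ∀ P, Mw P = m + ∑ κ, (1 - Real.cos (P κ)))
    (hh : ∀ P, h P = Mw P ^ 2 + ∑ κ, Real.sin (P κ) ^ 2)
    (hS : ∀ P, S P = ((h P)⁻¹ : ℂ) • (((Mw P : ℝ) : ℂ) • (1 : Matrix (Fin 4) (Fin 4) ℂ) -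
      I • ∑ κ, ((Real.sin (P κ) : ℝ) : ℂ) • euclideanGamma κ))
    (hmom : ∀ s κ, mom s κ = θ κ + Real.pi * ((s κ).val : ℝ))
    (hchi : ∀ s x, chi s x = (-1 : ℝ) ^ (∑ κ, (s κ).val * (x κ).val))
    (hYh : ∀ E s μ, Yh E s μ = ∑ x, ((chi s x : ℝ) : ℂ) • E (x, μ))
    (hpos : ∀ s, 0 < h (mom s)) (hY : ∀ e, (Y e)ᴴ = -Y e) :
    (B0⁻¹ * Dl fun e => Y e * Y e).trace.re / 2 = -((1 / 256 : ℝ) * ∑ s, ∑ μ, ∑ ν,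
      (if μ = ν then (1 / 2 : ℝ) * ∑ s', 4 * (Real.sin (mom s' μ) ^ 2 - Mw (mom s') * Real.cos (mom s' μ)) /
        h (mom s') else 0) * ((Yh Y s μ)ᴴ * Yh Y s ν).trace.re) := by
  obtain ⟨hat, hhat⟩ : ∃ hat : Matrix (TorusSite 4 2 × Fin 3 × Fin 4) (TorusSite 4 2 × Fin 3 × Fin 4) ℂ →
      (Fin 4 → ZMod 2) → (Fin 4 → ZMod 2) → Matrix (Fin 3 × Fin 4) (Fin 3 × Fin 4) ℂ, ∀ A k k', hat A k k' =
        ∑ y, ∑ z, ((chi k y * chi k' z : ℝ) : ℂ) • Matrix.of fun c c' : Fin 3 × Fin 4 => A (y, c) (z, c') :=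
    ⟨_, fun _ _ _ => rfl⟩
  -- the spin traces
  have hX : ∀ (k : Fin 4 → ZMod 2) (ν : Fin 4), (S (mom k) *
      ((-(1 / 2 : ℂ) * Complex.exp (↑(mom k ν) * I)) • ((1 : Matrix (Fin 4) (Fin 4) ℂ) - euclideanGamma ν) +
        (-(1 / 2 : ℂ) * Complex.exp (-(↑(mom k ν) * I))) •
          ((1 : Matrix (Fin 4) (Fin 4) ℂ) + euclideanGamma ν))).trace =
      ((4 * (Real.sin (mom k ν) ^ 2 - Mw (mom k) * Real.cos (mom k ν)) / h (mom k) : ℝ) : ℂ) := by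
    intro k ν
    rw [hS]
    exact trace_symbolInv_mul_hop (Mw (mom k)) (h (mom k)) (mom k) ν
  -- the colour traces: Parseval and `tr (Y Y) = −tr (Yᴴ Y)`
  have hYY : ∀ e, (Y e * Y e).trace = -((Y e)ᴴ * Y e).trace := fun e => by
    rw [(trace_mul_of_antiHerm _ _ (hY e) (hY e)).1, neg_neg]
  have h0 : ∀ x : TorusSite 4 2, chi 0 x = 1 := fun x => by simp [hchi]
  have hZ : ∀ μ, ∑ s, (((Yh Y s μ)ᴴ * Yh Y s μ).trace).re =
      -(16 * ((Yh (fun e => Y e * Y e) 0 μ).trace).re) := by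
    intro μ
    rw [← Complex.re_sum, ← Matrix.trace_sum, parseval chi Yh hchi hYh Y μ, hYh,
      show (16 : ℂ) = ((16 : ℝ) : ℂ) by norm_num]
    simp only [h0, Complex.ofReal_one, one_smul, Matrix.trace_smul, Matrix.trace_sum, hYY,
      Finset.sum_neg_distrib, Complex.neg_re, smul_eq_mul, Complex.re_ofReal_mul]
    ring
  rw [(trace_formulas m θ u B0 Mw h S mom chi hat hu hB0 hMw hh hS hmom hchi hhat hpos).1]
  simp only [hat_hop_sq θ u Dl mom chi Yh hat Y hu hDl hmom hchi hYh hhat hY, trace_kron_one, hX]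
  exact re_tadpole_bookkeeping (fun k ν => 4 * (Real.sin (mom k ν) ^ 2 - Mw (mom k) * Real.cos (mom k ν)) / h (mom k))
    (fun ν => (Yh (fun e => Y e * Y e) 0 ν).trace) (fun s μ ν => ((Yh Y s μ)ᴴ * Yh Y s ν).trace) hZ

/-- **The block Hessian in momentum space** (abstract form of `stub_blockHessianFormula`). -/
theorem blockHessian_eq (H : (Fin 4 → ZMod 2) → Fin 4 → Fin 4 → ℝ)
    (hu : ∀ μ, (u μ : Matrix (Fin 3) (Fin 3) ℂ) = Complex.exp (↑(θ μ) * I) • (1 : Matrix (Fin 3) (Fin 3) ℂ))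
    (hB0 : B0 = wilsonDirac (unitaryFundamentalRep (Fin 3) ℂ) (fun e : Edge 4 2 => u e.2) m 1)
    (hDl : ∀ E, Dl E = Matrix.of fun p q : TorusSite 4 2 × Fin 3 × Fin 4 => -(1 / 2 : ℂ) * ∑ μ : Fin 4,
      ((if q.1 = Site.shift p.1 μ then ((1 : Matrix (Fin 4) (Fin 4) ℂ) - euclideanGamma μ) p.2.2 q.2.2 *
          ((u μ : Matrix (Fin 3) (Fin 3) ℂ) * E (p.1, μ)) p.2.1 q.2.1 else 0) +
        (if p.1 = Site.shift q.1 μ then ((1 : Matrix (Fin 4) (Fin 4) ℂ) + euclideanGamma μ) p.2.2 q.2.2 *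
          ((u μ : Matrix (Fin 3) (Fin 3) ℂ) * E (q.1, μ))ᴴ p.2.1 q.2.1 else 0)))
    (hMw : ∀ P, Mw P = m + ∑ κ, (1 - Real.cos (P κ)))
    (hh : ∀ P, h P = Mw P ^ 2 + ∑ κ, Real.sin (P κ) ^ 2)
    (hS : ∀ P, S P = ((h P)⁻¹ : ℂ) • (((Mw P : ℝ) : ℂ) • (1 : Matrix (Fin 4) (Fin 4) ℂ) -
      I • ∑ κ, ((Real.sin (P κ) : ℝ) : ℂ) • euclideanGamma κ))
    (hV : ∀ P q μ, V P q μ = (-(1 / 2 : ℂ) * (Complex.exp (↑(P μ) * I) * I)) •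
        ((1 : Matrix (Fin 4) (Fin 4) ℂ) - euclideanGamma μ) +
      (-(1 / 2 : ℂ) * (Complex.exp (-(↑(P μ + q μ) * I)) * (-I))) • ((1 : Matrix (Fin 4) (Fin 4) ℂ) + euclideanGamma μ))
    (hmom : ∀ s κ, mom s κ = θ κ + Real.pi * ((s κ).val : ℝ))
    (hqv : ∀ s κ, qv s κ = Real.pi * ((s κ).val : ℝ))
    (hH : ∀ s μ ν, H s μ ν = (if μ = ν then (1 / 2 : ℝ) * ∑ s' : Fin 4 → ZMod 2,
        4 * (Real.sin (mom s' μ) ^ 2 - Mw (mom s') * Real.cos (mom s' μ)) / h (mom s') else 0) +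
      (1 / 2 : ℝ) * (∑ s' : Fin 4 → ZMod 2, (S (mom s') * V (mom s' + qv s) (qv s) ν * S (mom s' + qv s) *
        V (mom s') (qv s) μ).trace).re)
    (hchi : ∀ s x, chi s x = (-1 : ℝ) ^ (∑ κ, (s κ).val * (x κ).val))
    (hYh : ∀ E s μ, Yh E s μ = ∑ x, ((chi s x : ℝ) : ℂ) • E (x, μ))
    (hpos : ∀ s, 0 < h (mom s)) (hY : ∀ e, (Y e)ᴴ = -Y e) :
    (B0⁻¹ * Dl Y * (B0⁻¹ * Dl Y)).trace.re / 2 - (B0⁻¹ * Dl (fun e => Y e * Y e)).trace.re / 2 =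
      (1 / 256 : ℝ) * ∑ s, ∑ μ, ∑ ν, H s μ ν * ((Yh Y s μ)ᴴ * Yh Y s ν).trace.re := by
  rw [bubble_eq m θ u B0 Dl Mw h S V mom qv chi Yh Y hu hB0 hDl hMw hh hS hV hmom hqv hchi hYh hpos hY,
    tadpole_eq m θ u B0 Dl Mw h S mom chi Yh Y hu hB0 hDl hMw hh hS hmom hchi hYh hpos hY, sub_neg_eq_add]
  simp only [hH, add_mul, Finset.sum_add_distrib, mul_add]
  ring

end Main

end BlockHessianFormula

open BlockHessianFormula in
/-- **The block Hessian in momentum space** (stub `stub_blockHessianFormula`): on the `2⁴` block with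
constant central phases `u_μ = e^{iθ_μ}·1` (all `h(θ + πs) > 0`), for every anti-Hermitian link field `Y`,
`½ Re tr (B⁰⁻¹ΔY B⁰⁻¹ΔY) − ½ Re tr (B⁰⁻¹Δ(Y⋆Y)) = (1/256) Σ_s Σ_{μν} H_θ(s)_{μν} Re tr (Ŷ_μ(s)ᴴ Ŷ_ν(s))`
with `H = ½ X δ + ½ Re B` (tadpole `X_μ = Σ_{s'} 4(sin² P_μ − M_W cos P_μ)/h`, bubble
`B_{μν}(s) = Σ_{s'} tr (S(P) V_ν(P + q_s, q_s) S(P + q_s) V_μ(P, q_s))`, `P = θ + πs'`, `q_s = πs`). -/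
theorem stub_blockHessianFormula : ∀ (m : ℝ) (θ : Fin 4 → ℝ) (u : Fin 4 → Matrix.unitaryGroup (Fin 3) ℂ), (∀ μ, ((u μ : Matrix.unitaryGroup (Fin 3) ℂ) : Matrix (Fin 3) (Fin 3) ℂ) = Complex.exp (↑(θ μ) * Complex.I) • (1 : Matrix (Fin 3) (Fin 3) ℂ)) → let B0 : Matrix (TorusSite 4 2 × Fin 3 × Fin 4) (TorusSite 4 2 × Fin 3 × Fin 4) ℂ := wilsonDirac (unitaryFundamentalRep (Fin 3) ℂ) (fun e : Edge 4 2 => u e.2) m 1; let Dl : (Edge 4 2 → Matrix (Fin 3) (Fin 3) ℂ) → Matrix (TorusSite 4 2 × Fin 3 × Fin 4) (TorusSite 4 2 × Fin 3 × Fin 4) ℂ := fun E => Matrix.of fun p q => -(1 / 2 : ℂ) * ∑ μ : Fin 4, ((if q.1 = Site.shift p.1 μ then ((1 : Matrix (Fin 4) (Fin 4) ℂ) - euclideanGamma μ) p.2.2 q.2.2 * (((u μ : Matrix.unitaryGroup (Fin 3) ℂ) : Matrix (Fin 3) (Fin 3) ℂ) * E (p.1, μ)) p.2.1 q.2.1 else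 0) + (if p.1 = Site.shift q.1 μ then ((1 : Matrix (Fin 4) (Fin 4) ℂ) + euclideanGamma μ) p.2.2 q.2.2 * (((u μ : Matrix.unitaryGroup (Fin 3) ℂ) : Matrix (Fin 3) (Fin 3) ℂ) * E (q.1, μ))ᴴ p.2.1 q.2.1 else 0)); let Mw : (Fin 4 → ℝ) → ℝ := fun P => m + ∑ κ : Fin 4, (1 - Real.cos (P κ)); let h : (Fin 4 → ℝ) → ℝ := fun P => Mw P ^ 2 + ∑ κ : Fin 4, Real.sin (P κ) ^ 2; let S : (Fin 4 → ℝ) → Matrix (Fin 4) (Fin 4) ℂ := fun P => ((h P)⁻¹ : ℂ) • (((Mw P : ℝ) : ℂ) • (1 : Matrix (Fin 4) (Fin 4) ℂ) - Complex.I • ∑ κ : Fin 4, ((Real.sin (P κ) : ℝ) : ℂ) • euclideanGamma κ); let V : (Fin 4 → ℝ) → (Fin 4 → ℝ) → Fin 4 → Matrix (Fin 4) (Fin 4) ℂ := fun P q μ => (-(1 / 2 : ℂ) * (Complex.exp (↑(P μ) * Complex.I) * Complex.I)) • ((1 : Matrix (Fin 4) (Fin 4) ℂ) - euclideanGamma μ)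 + (-(1 / 2 : ℂ) * (Complex.exp (-(↑(P μ + q μ) * Complex.I)) * (-Complex.I))) • ((1 : Matrix (Fin 4) (Fin 4) ℂ) + euclideanGamma μ); let mom : (Fin 4 → ZMod 2) → (Fin 4 → ℝ) := fun s κ => θ κ + Real.pi * ((s κ).val : ℝ); let qv : (Fin 4 → ZMod 2) → (Fin 4 → ℝ) := fun s κ => Real.pi * ((s κ).val : ℝ); let H : (Fin 4 → ZMod 2) → Fin 4 → Fin 4 → ℝ := fun s μ ν => (if μ = ν then (1 / 2 : ℝ) * ∑ s' : Fin 4 → ZMod 2, 4 * (Real.sin (mom s' μ) ^ 2 - Mw (mom s') * Real.cos (mom s' μ)) / h (mom s') else 0) + (1 / 2 : ℝ) * (∑ s' : Fin 4 → ZMod 2, (S (mom s') * V (mom s' + qv s) (qv s) ν * S (mom s' + qv s) * V (mom s') (qv s) μ).trace).re; let chi : (Fin 4 → ZMod 2) → TorusSite 4 2 → ℝ := fun s x => (-1 : ℝ) ^ (∑ κ : Fin 4, (s κ).val * (x κ).val); let Yh : (Edge 4 2 → Matrix (Fin 3) (Fin 3) ℂ) → (Fin 4 → ZMod 2) → Fin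 4 → Matrix (Fin 3) (Fin 3) ℂ := fun Y s μ => ∑ x : TorusSite 4 2, ((chi s x : ℝ) : ℂ) • Y (x, μ); (∀ s' : Fin 4 → ZMod 2, 0 < h (mom s')) → ∀ Y : Edge 4 2 → Matrix (Fin 3) (Fin 3) ℂ, (∀ e, (Y e)ᴴ = -Y e) → (B0⁻¹ * Dl Y * (B0⁻¹ * Dl Y)).trace.re / 2 - (B0⁻¹ * Dl (fun e => Y e * Y e)).trace.re / 2 = (1 / 256 : ℝ) * ∑ s : Fin 4 → ZMod 2, ∑ μ : Fin 4, ∑ ν : Fin 4, H s μ ν * ((Yh Y s μ)ᴴ * Yh Y s ν).trace.re := by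
  intro m θ u hu B0 Dl Mw h S V mom qv H chi Yh hpos Y hY
  exact blockHessian_eq m θ u B0 Dl Mw h S V mom qv chi Yh Y H hu rfl (fun _ => rfl) (fun _ => rfl)
    (fun _ => rfl) (fun _ => rfl) (fun _ _ _ => rfl) (fun _ _ => rfl) (fun _ _ => rfl) (fun _ _ _ => rfl)
    (fun _ _ => rfl) (fun _ _ _ => rfl) hpos hY


end Summit.QuantumFields.QCD.Cruxes.CriticalLineDiamagnetism.ChessboardCellGain

end
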